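/-
Copyright (c) 2026 the pub-hodgecm-mathlib formalisation cell (harness21).  Prover seat hodgecm-mathlib-K2E3-p03 (g2), Track B «K2-LIT» ∕ h413, road J ∕ R3 brick
«R3b-ram-2a» (dealer K2E3-plan (g2) (D5), road owner K2E3-p15 (g2)): the anisotropic plane with a NON-NORM UNIT `ξ` on the CM carrier — `K_v = ⊤`, compactness.  2026-09-04.
-/
import Literature.NumberTheory.Weil1982.UnitaryFinTopFormAnisotropicPlaneCount        -- ★ R3b-2 (K2E3-p15): `valued_det_eq_one_of_mem_unitaryGroupOfForm`, `placeForm_anisoPlane`, `galAdicCompletionMap_anisoXi` (the `ord ξ = 1` twin)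
import Literature.NumberTheory.Automorphic.UnitaryAnisotropicPlaneValuationsUnit       -- ★ R3b-ram-1 (this seat): `anisoPlane_valued_le_of_unit`
import Literature.NumberTheory.Automorphic.UnitaryLatticeTreeAnisotropicPlane           -- ★ `valued_neg_add_norm_eq_one_of_not_norm` (a non-norm unit is residually a non-norm)
import HarnessLib

/-!
# The anisotropic unitary plane `U(⟨1, −ξ⟩)`, `ξ` a NON-NORM UNIT: it is its own integral model (`U ≤ GL₂(𝒪_K)`), and on the CM carrier at a non-split place
# `K_v = U(⟨1,−ξ⟩)(L⁺_v)` is COMPACT (Rogawski 1990 §3.8 p. 33; Platonov–Rapinchuk 1994 §3.3; Serre, *Local Fields* V §3)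

Topic `NumberTheory/Weil1982`; namespace `Literature.NumberTheory.Weil1982.UnitaryFinTopForm` (continues ★ R3b-2 `UnitaryFinTopFormAnisotropicPlaneCount`).  THEOREMS ONLY
(no definition, no instance, no notation, no named fact, no `sorry`); kernel lane `--kind proof --supports stmt-HodgeConjecture-24833` (count-neutral).  Cell `pub/hodgecm-mathlib`,
crux H413 = `stmt-HodgeConjecture-24833`, Track B E3∕E4 junction ‹S›, ROAD J, letter **J3** `sig_K2E3CompatibleMeasureEPIdentityRankOne` (v2; road owner K2E3-p15 (g2));
(r)-class = ramified `v ∤ 2` (REPORT-R3ram-1∕2, K2E3-p03 (g2)); brick **R3b-ram-2a** — the (r)-twin of ★ R3b-2 §1∕§1′: at a tamely ramified place the compact sheet's plane is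
`⟨1, −ξ⟩` with `ξ` a UNIT that is NOT A NORM from `L_w` (§0: then `|σu·u − ξ| = 1` for every unit `u`, ★ `valued_neg_add_norm_eq_one_of_not_norm` under the (norm)-with-level
clause), so every element is integral (★ R3b-ram-1), `U ≤ GL₂(𝒪)` with unit determinant (§1), and on the CM carrier `K_v = ⊤`, `Z(1) ∩ K_v = ⊤`, `CompactSpace` (§2) — the inputs
★ R3c `finTamagawaPartner_univ_mul_relIndex_eq_of_compactSpace` and ★ R3a-1 §3 want for the compact block of ‹J3› (r).  The residual COUNT `[U : U(ϖ_v)]` is R3b-ram-2b (sequel).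
* §0 `valued_normSub_unit_eq_one_of_not_norm` (the letter `hξN` of ★ R3b-ram-1 from «`ξ` is not a norm» + the (norm)-with-level clause).
* §1 `unitaryGroupOfForm_anisoPlane_le_glInt_of_unit` (private: `U ≤ GL₂(𝒪)`).
* §2 **`anisoPlaneUnit_integralLevel_top_and_compactSpace`** (`K_v = ⊤ ∧ Z(1) ∩ K_v = ⊤ ∧ CompactSpace`, one conjunction — the three (u)-shaped conclusions are the
  inert file's names, so the (r) versions are packaged to keep the tree's statements distinct).
HONEST LABEL: count-neutral; HC_CM is proved only modulo the 7 printed citations (2 remaining named inputs: hLiu418 = `stmt-HodgeConjecture-24832`, h413 = `stmt-HodgeConjecture-24833`)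
until rung 0 closes; J3 is NOT proved here.

## References
* [Rogawski1990] J. D. Rogawski, *Automorphic Representations of Unitary Groups in Three Variables*, Ann. of Math. Stud. 123 (1990), §3.8 p. 33.
* [PlatonovRapinchuk1994] V. Platonov, A. Rapinchuk, *Algebraic Groups and Number Theory* (1994), §3.3, §5.1.
* [Serre1979] J.-P. Serre, *Local Fields*, GTM 67 (1979), Ch. V §3.
-/

set_option autoImplicit false

noncomputable section

open NumberField IsDedekindDomain Matrix ValuativeRel WithZero
open Literature.NumberTheory.Automorphic Literature.NumberTheory.Automorphic.UnitaryGroup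
open Literature.NumberTheory.Automorphic.HermitianLatticeTree (mem_glInt_iff_forall_v_le_one_and_v_det_eq_one)
open scoped MatrixGroups Matrix NNReal

namespace Literature.NumberTheory.Weil1982.UnitaryFinTopForm

/-! ## §0 «not a norm» ⇒ the letter `hξN` -/

section NotNorm

variable {K : Type*} [Field K] [Valued K ℤᵐ⁰] {σ : K →+* K} (hσ : ∀ a, σ (σ a) = a) (hvσ : ∀ a, Valued.v (σ a) = Valued.v a)
  {ξ : K} (hσξ : σ ξ = ξ) (hξ1 : Valued.v ξ = 1) (hξn : ¬ ∃ z : K, z * σ z = ξ)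
  (hnorm : ∀ u : K, σ u = u → Valued.v (u - 1) < 1 → ∃ z : K, z * σ z = u)

include hσ hvσ hσξ hξ1 hξn hnorm in
/-- **A non-norm unit is residually a non-norm**: `|σu·u − ξ| = 1` for every unit `u` (★ `valued_neg_add_norm_eq_one_of_not_norm`: otherwise `ξ∕N(u) ≡ 1` would be a norm by the
(norm)-with-level clause). [cite: Serre1979, Ch. V §3] [cite: Rogawski1990, §3.8 p. 33] -/
theorem valued_normSub_unit_eq_one_of_not_norm (u : K) (hu : Valued.v u = 1) : Valued.v (σ u * u - ξ) = 1 := by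
  have h := UnitaryLatticeTree.valued_neg_add_norm_eq_one_of_not_norm hσ hvσ hσξ hξ1 hξn hnorm u hu.le
  rwa [one_mul, neg_add_eq_sub] at h

end NotNorm

/-! ## §1 The anisotropic plane with a non-norm unit is its own integral model -/

section Integral

variable {K : Type*} [Field K] [Valued K ℤᵐ⁰] (σ : K →+* K) (hvσ : ∀ x, Valued.v (σ x) = Valued.v x)
  [ValuativeRel K] [(Valued.v : Valuation K ℤᵐ⁰).Compatible] {ξ : K} (hξ1 : Valued.v ξ = 1) (hξN : ∀ u : K, Valued.v u = 1 → Valued.v (σ u * u - ξ) = 1)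

include hvσ hξ1 hξN in
/-- **`U(σ, diag(1,−ξ))(K) ≤ GL₂(𝒪_K)`** for a non-norm unit `ξ`: every element has integral entries (★ `anisoPlane_valued_le_of_unit`) and unit determinant (★
`valued_det_eq_one_of_mem_unitaryGroupOfForm`). [cite: PlatonovRapinchuk1994, §3.3] [cite: Rogawski1990, §3.8 p. 33] -/
private theorem unitaryGroupOfForm_anisoPlane_le_glInt_of_unit : unitaryGroupOfForm σ !![(1 : K), 0; 0, -ξ] ≤ glInt 2 K := by
  intro g hg
  have hξ0 : ξ ≠ 0 := fun h => by rw [h, map_zero] at hξ1; exact zero_ne_one hξ1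
  have hdetJ : (!![(1 : K), 0; 0, -ξ]).det ≠ 0 := by
    rw [Matrix.det_fin_two_of]; simpa using hξ0
  obtain ⟨ha, hb, hc, hd⟩ := anisoPlane_valued_le_of_unit σ hvσ hξ1 hξN hg
  refine (mem_glInt_iff_forall_v_le_one_and_v_det_eq_one g).2 ⟨fun i j => ?_, valued_det_eq_one_of_mem_unitaryGroupOfForm σ hvσ hdetJ hg⟩
  fin_cases i <;> fin_cases j
  · exact ha
  · exact hb
  · exact hc
  · exact hd

end Integral

/-! ## §2 The CM reading at a non-split place: `K_v = U(⟨1,−ξ⟩)(L⁺_v)` and compactness -/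

section CM

variable (L : Type) [Field L] [NumberField L] [IsCMField L] (v : HeightOneSpectrum (𝓞 ↥(maximalRealSubfield L)))
  (w : PlacesOver L v) (hw : IsCMField.complexConj L • w.1 = w.1) {ξ : L}
  (hξ1 : Valued.v (algebraMap L (w.1.adicCompletion L) ξ) = 1)
  (hξN : ∀ u : w.1.adicCompletion L, Valued.v u = 1 →
    Valued.v (galAdicCompletionMap (L := L) (IsCMField.complexConj L) hw u * u - algebraMap L (w.1.adicCompletion L) ξ) = 1)

include hξ1 hξN in
/-- **`K_v = U(⟨1,−ξ⟩)(L⁺_v)`** on the CM carrier at a non-split place for a non-norm unit `ξ_w`: `cmLocalIntegralLevel = ⊤` (the one-place model ★ `localNonsplitEquiv` lands in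
`U(σ_w, diag(1,−ξ_w))(L_w) ≤ GL₂(𝒪_w)`, §1). [cite: PlatonovRapinchuk1994, §3.3, §5.1] -/
private theorem cmLocalIntegralLevel_anisoPlaneUnit_eq_top' : cmLocalIntegralLevel L 2 !![(1 : L), 0; 0, -ξ] v = ⊤ := by
  have hc1 : IsCMField.complexConj L ≠ 1 := IsCMField.complexConj_ne_one L
  refine eq_top_iff.2 fun g _ => (mem_localIntegralLevel_iff (IsCMField.complexConj L) 2 !![(1 : L), 0; 0, -ξ] v g).2 fun w' => ?_
  obtain rfl : w' = w := PlacesOver.eq_of_smul_eq (IsCMField.complexConj L) hc1 w hw w'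
  have hmem : localGLPiEquiv L 2 v (g.val : GL (Fin 2) (LocalRing L v)) w' ∈
      unitaryGroupOfForm (galAdicCompletionMap (L := L) (IsCMField.complexConj L) hw) !![(1 : w'.1.adicCompletion L), 0; 0, -(algebraMap L (w'.1.adicCompletion L) ξ)] := by
    rw [← placeForm_anisoPlane L v w' ξ]
    exact (localNonsplitEquiv (IsCMField.complexConj L) !![(1 : L), 0; 0, -ξ] hc1 w' hw g).2
  exact unitaryGroupOfForm_anisoPlane_le_glInt_of_unit (galAdicCompletionMap (L := L) (IsCMField.complexConj L) hw)
    (valued_galAdicCompletionMap (L := L) (IsCMField.complexConj L) hw) hξ1 hξN hmem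

include hξ1 hξN in
/-- **THE INTEGRAL PACKAGE of the anisotropic plane with a NON-NORM UNIT `ξ_w` on the CM carrier at a non-split place**: `K_v = U(⟨1,−ξ⟩)(L⁺_v)` (`cmLocalIntegralLevel = ⊤`),
`Z(1) ∩ K_v = ⊤`, and `U(⟨1,−ξ⟩)(L⁺_v)` IS COMPACT (it equals its own compact open level) — the (r)-twin of ★ `cmLocalIntegralLevel_anisoPlane_eq_top` ∕
`centralizer_one_inf_cmLocalIntegralLevel_anisoPlane_eq_top` ∕ `compactSpace_anisoPlane` (there `|ξ|_w = exp(−1)`), packaged as one conjunction.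
[cite: PlatonovRapinchuk1994, §3.3, §5.1] [cite: Rogawski1990, §3.8 p. 33] -/
theorem anisoPlaneUnit_integralLevel_top_and_compactSpace :
    cmLocalIntegralLevel L 2 !![(1 : L), 0; 0, -ξ] v = ⊤ ∧
      Subgroup.centralizer ({(1 : (cmDatum L 2 !![(1 : L), 0; 0, -ξ]).Local v)} : Set ((cmDatum L 2 !![(1 : L), 0; 0, -ξ]).Local v)) ⊓
        cmLocalIntegralLevel L 2 !![(1 : L), 0; 0, -ξ] v = ⊤ ∧
      CompactSpace ((cmDatum L 2 !![(1 : L), 0; 0, -ξ]).Local v) := by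
  have htop := cmLocalIntegralLevel_anisoPlaneUnit_eq_top' L v w hw hξ1 hξN
  refine ⟨htop, by rw [centralizer_one_inf_eq, htop], ?_⟩
  have h := (isCompact_isOpen_cmLocalIntegralLevel L 2 !![(1 : L), 0; 0, -ξ] v).1
  rw [htop, Subgroup.coe_top] at h
  exact ⟨h⟩

end CM

end Literature.NumberTheory.Weil1982.UnitaryFinTopForm

end
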